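import Literature.Analysis.SpecialFunctions.DigammaLogBound
import Literature.Analysis.Complex.TermwiseIteratedDeriv
import HarnessLib

/-!
# The polygamma series: `ψ^{(k)}(w) = (−1)^{k+1} k! ∑_{j ≥ 0} (w + j)^{−(k+1)}` for `Re w > 0`, `k ≥ 1`

Topic `Literature/Analysis/SpecialFunctions`, namespace `Literature.Analysis.SpecialFunctions.Complex`
(sibling of `DigammaGauss.lean`, which proves Gauss' series `ψ(w) + γ = ∑_j (1/(j+1) − 1/(w+j))`,
`hasSum_one_div_sub_one_div_digamma`).  Everything here is PROVED (theorems only).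

* `hasSum_iteratedDeriv_digamma` — for `0 < Re w` and `1 ≤ k`,
  `HasSum (j ↦ (−1)^{k+1} k! (w + j)^{−(k+1)}) (ψ^{(k)}(w))` (Andrews–Askey–Roy (1.2.14):
  termwise differentiation of (1.2.13), here via `Literature.Analysis.Complex.hasSum_iteratedDeriv_of_summable_norm`
  on the disc `|z − w| ≤ min(Re w/2, 1)`);
* `hasSum_iteratedDeriv_digamma_half` — the same for `z ↦ ψ(z/2)/2` (the digamma part of
  `Γ_ℝ'/Γ_ℝ`): `HasSum (j ↦ (−1)^{k+1} k! (s + 2j)^{−(k+1)}) ((ψ(·/2)/2)^{(k)}(s))` for `0 < Re s`.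

These are the "trivial-zero" terms of the explicit formula for the higher derivatives of `−L'/L`
[cite: ThornerZaman2017, §7 (7.3)].

## References

* G. E. Andrews, R. Askey, R. Roy, *Special Functions*, CUP 1999, Thm. 1.2.5, (1.2.13)–(1.2.14).
  [AndrewsAskeyRoy1999]
* J. Thorner, A. Zaman, *An explicit bound for the least prime ideal in the Chebotarev density
  theorem*, Algebra Number Theory 11 (2017), §7. [ThornerZaman2017]
-/

noncomputable section

open Complex Metric Set Filter Topology

namespace Literature.Analysis.SpecialFunctions.Complex

open Literature.Analysis.Complex (hasSum_iteratedDeriv_of_summable_norm iteratedDeriv_inv_add_const)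

/-- `∑_j 1/(j+1)²` converges (shifted Basel series). [folklore] -/
theorem summable_one_div_nat_add_one_sq : Summable fun j : ℕ ↦ 1 / ((j : ℝ) + 1) ^ 2 := by
  have h := Real.summable_one_div_nat_pow.2 one_lt_two
  exact_mod_cast (summable_nat_add_iff 1).2 h

/-- Points of the closed disc `|z − w| ≤ R` with `R ≤ Re w/2` have `Re z ≥ Re w/2 ≥ R`. [folklore] -/
theorem re_ge_of_mem_closedBall {w z : ℂ} {R : ℝ} (hR : R ≤ w.re / 2) (hz : z ∈ closedBall w R) :
    w.re / 2 ≤ z.re := by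
  rw [mem_closedBall, dist_eq_norm] at hz
  have h := (abs_re_le_norm (z - w)).trans hz
  rw [sub_re, abs_le] at h
  linarith [h.1]

/-- **The polygamma series** (Andrews–Askey–Roy (1.2.14)): for `0 < Re w` and `k ≥ 1`,
`ψ^{(k)}(w) = (−1)^{k+1} k! ∑_{j≥0} (w + j)^{−(k+1)}`. [cite: AndrewsAskeyRoy1999, Thm 1.2.5 (1.2.14)] -/
theorem hasSum_iteratedDeriv_digamma {w : ℂ} (hw : 0 < w.re) {k : ℕ} (hk : 1 ≤ k) :
    HasSum (fun j : ℕ ↦ (-1) ^ (k + 1) * (k.factorial : ℂ) * ((w + j) ^ (k + 1))⁻¹)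
      (iteratedDeriv k digamma w) := by
  -- the disc
  set R : ℝ := min (w.re / 2) 1 with hR
  have hRpos : 0 < R := lt_min (by linarith) one_pos
  have hRle : R ≤ w.re / 2 := min_le_left _ _
  have hR1 : R ≤ 1 := min_le_right _ _
  have hre : ∀ z ∈ closedBall w R, 0 < z.re := fun z hz ↦
    lt_of_lt_of_le (by linarith) (re_ge_of_mem_closedBall hRle hz)
  -- the terms and their bound on the circle
  set f : ℕ → ℂ → ℂ := fun j z ↦ 1 / ((j : ℂ) + 1) - 1 / (z + j) with hf
  set u : ℕ → ℝ := fun j ↦ (‖w‖ + R + 1) / R * (1 / ((j : ℝ) + 1) ^ 2) with hu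
  have hu_sum : Summable u := summable_one_div_nat_add_one_sq.mul_left _
  have hle : ∀ j, ∀ z ∈ sphere w R, ‖f j z‖ ≤ u j := by
    intro j z hz
    have hzre : R ≤ z.re := hRle.trans (re_ge_of_mem_closedBall hRle (sphere_subset_closedBall hz))
    have hz0 : 0 < z.re := lt_of_lt_of_le hRpos hzre
    have h1 := norm_one_div_sub_one_div_le hz0 j
    have hmin : R ≤ min z.re 1 := le_min hzre hR1
    have hnorm : ‖z - 1‖ ≤ ‖w‖ + R + 1 := by
      rw [mem_sphere, dist_eq_norm] at hz
      calc ‖z - 1‖ = ‖(z - w) + (w - 1)‖ := by ring_nf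
        _ ≤ ‖z - w‖ + ‖w - 1‖ := norm_add_le _ _
        _ ≤ R + (‖w‖ + 1) := by rw [hz]; gcongr; exact (norm_sub_le _ _).trans (by simp)
        _ = ‖w‖ + R + 1 := by ring
    have hj : (0 : ℝ) < ((j : ℝ) + 1) ^ 2 := by positivity
    calc ‖f j z‖ ≤ ‖z - 1‖ / (min z.re 1 * ((j : ℝ) + 1) ^ 2) := h1
      _ ≤ (‖w‖ + R + 1) / (R * ((j : ℝ) + 1) ^ 2) := by gcongr
      _ = u j := by rw [hu]; dsimp only; field_simp
  -- differentiability
  have hf_diff : ∀ j, DifferentiableOn ℂ (f j) (closedBall w R) := by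
    intro j z hz
    have hzj : z + j ≠ 0 := fun h ↦ by
      have := congrArg Complex.re h; simp at this; linarith [hre z hz]
    refine DifferentiableAt.differentiableWithinAt ?_
    exact (differentiableAt_const _).sub
      ((differentiableAt_const _).div (differentiableAt_id.add_const _) hzj)
  set g : ℂ → ℂ := fun z ↦ digamma z + Real.eulerMascheroniConstant with hg
  have hg_diff : DifferentiableOn ℂ g (closedBall w R) := fun z hz ↦
    ((differentiableOn_digamma z (hre z hz)).differentiableAt
      ((isOpen_lt continuous_const continuous_re).mem_nhds (hre z hz))).differentiableWithinAt.add_const _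
  have hsum : ∀ z ∈ sphere w R, HasSum (fun j ↦ f j z) (g z) := fun z hz ↦
    hasSum_one_div_sub_one_div_digamma (hre z (sphere_subset_closedBall hz))
  have key := hasSum_iteratedDeriv_of_summable_norm hRpos hu_sum hf_diff hle hg_diff hsum k
  -- evaluate
  have hk0 : 0 < k := hk
  have hg_eval : iteratedDeriv k g w = iteratedDeriv k digamma w := by
    rw [hg]
    have : (fun z ↦ digamma z + (Real.eulerMascheroniConstant : ℂ)) =
        fun z ↦ (Real.eulerMascheroniConstant : ℂ) + digamma z := by funext z; ring
    rw [this, iteratedDeriv_const_add hk0]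
  have hf_eval : ∀ j : ℕ, iteratedDeriv k (f j) w =
      (-1) ^ (k + 1) * (k.factorial : ℂ) * ((w + j) ^ (k + 1))⁻¹ := by
    intro j
    rw [hf]; dsimp only
    rw [iteratedDeriv_const_sub hk0]
    have : (-fun z : ℂ ↦ 1 / (z + j)) = fun z ↦ (-1) * (fun x : ℂ ↦ (x + (j : ℂ))⁻¹) z := by
      funext z; simp
    rw [this, iteratedDeriv_const_mul_field, iteratedDeriv_inv_add_const]
    ring
  rw [hg_eval] at key
  exact key.congr_fun fun j ↦ (hf_eval j).symm

/-- The digamma part of `Γ_ℝ'/Γ_ℝ`, differentiated: for `0 < Re s` and `k ≥ 1`,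
`(ψ(·/2)/2)^{(k)}(s) = (−1)^{k+1} k! ∑_{j≥0} (s + 2j)^{−(k+1)}`.
[cite: AndrewsAskeyRoy1999, Thm 1.2.5 (1.2.14)] -/
theorem hasSum_iteratedDeriv_digamma_half {s : ℂ} (hs : 0 < s.re) {k : ℕ} (hk : 1 ≤ k) :
    HasSum (fun j : ℕ ↦ (-1) ^ (k + 1) * (k.factorial : ℂ) * ((s + 2 * j) ^ (k + 1))⁻¹)
      (iteratedDeriv k (fun z ↦ digamma (z / 2) / 2) s) := by
  -- the disc
  set R : ℝ := min (s.re / 2) 1 with hR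
  have hRpos : 0 < R := lt_min (by linarith) one_pos
  have hRle : R ≤ s.re / 2 := min_le_left _ _
  have hR1 : R ≤ 1 := min_le_right _ _
  have hre : ∀ z ∈ closedBall s R, 0 < z.re := fun z hz ↦
    lt_of_lt_of_le (by linarith) (re_ge_of_mem_closedBall hRle hz)
  have hre2 : ∀ z ∈ closedBall s R, 0 < (z / 2).re := fun z hz ↦ by
    have := hre z hz; simp; linarith
  -- the terms: `(1/(j+1) − 1/(z/2 + j))/2 = 1/(2(j+1)) − 1/(z + 2j)`
  set f : ℕ → ℂ → ℂ := fun j z ↦ (1 / ((j : ℂ) + 1) - 1 / (z / 2 + j)) / 2 with hf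
  set u : ℕ → ℝ := fun j ↦ (‖s‖ + R + 2) / (2 * R) * (1 / ((j : ℝ) + 1) ^ 2) with hu
  have hu_sum : Summable u := summable_one_div_nat_add_one_sq.mul_left _
  have hle : ∀ j, ∀ z ∈ sphere s R, ‖f j z‖ ≤ u j := by
    intro j z hz
    have hzre : R ≤ z.re := hRle.trans (re_ge_of_mem_closedBall hRle (sphere_subset_closedBall hz))
    have hz0 : 0 < (z / 2).re := hre2 z (sphere_subset_closedBall hz)
    have h1 := norm_one_div_sub_one_div_le hz0 j
    have hmin : R / 2 ≤ min (z / 2).re 1 := le_min (by simp; linarith) (by linarith)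
    have hnorm : ‖z / 2 - 1‖ ≤ (‖s‖ + R + 2) / 2 := by
      rw [mem_sphere, dist_eq_norm] at hz
      have : z / 2 - 1 = ((z - s) + (s - 2)) / 2 := by ring
      rw [this, norm_div, Complex.norm_two]
      gcongr
      calc ‖(z - s) + (s - 2)‖ ≤ ‖z - s‖ + ‖s - 2‖ := norm_add_le _ _
        _ ≤ R + (‖s‖ + 2) := by rw [hz]; gcongr; exact (norm_sub_le _ _).trans (by simp)
        _ = ‖s‖ + R + 2 := by ring
    have hj : (0 : ℝ) < ((j : ℝ) + 1) ^ 2 := by positivity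
    rw [hf]; dsimp only
    rw [norm_div, Complex.norm_two]
    calc ‖1 / ((j : ℂ) + 1) - 1 / (z / 2 + j)‖ / 2
        ≤ (‖z / 2 - 1‖ / (min (z / 2).re 1 * ((j : ℝ) + 1) ^ 2)) / 2 := by gcongr
      _ ≤ ((‖s‖ + R + 2) / 2 / (R / 2 * ((j : ℝ) + 1) ^ 2)) / 2 := by gcongr
      _ = u j := by rw [hu]; dsimp only; field_simp
  -- differentiability
  have hf_diff : ∀ j, DifferentiableOn ℂ (f j) (closedBall s R) := by
    intro j z hz
    have hzj : z / 2 + j ≠ 0 := fun h ↦ by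
      have := congrArg Complex.re h; simp at this; linarith [hre z hz]
    refine DifferentiableAt.differentiableWithinAt ?_
    have hd : DifferentiableAt ℂ (fun y : ℂ ↦ y / 2 + (j : ℂ)) z :=
      (differentiableAt_id.div_const 2).add_const _
    exact ((differentiableAt_const _).sub ((differentiableAt_const (1 : ℂ)).div hd hzj)).div_const 2
  set g : ℂ → ℂ := fun z ↦ (digamma (z / 2) + Real.eulerMascheroniConstant) / 2 with hg
  have hdig : ∀ z ∈ closedBall s R, DifferentiableAt ℂ (fun z ↦ digamma (z / 2)) z := by
    intro z hz
    have h1 : DifferentiableAt ℂ digamma (z / 2) :=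
      (differentiableOn_digamma (z / 2) (hre2 z hz)).differentiableAt
        ((isOpen_lt continuous_const continuous_re).mem_nhds (hre2 z hz))
    exact h1.comp z (differentiableAt_id.div_const 2)
  have hg_diff : DifferentiableOn ℂ g (closedBall s R) := fun z hz ↦
    (((hdig z hz).add_const _).div_const 2).differentiableWithinAt
  have hsum : ∀ z ∈ sphere s R, HasSum (fun j ↦ f j z) (g z) := fun z hz ↦
    (hasSum_one_div_sub_one_div_digamma (hre2 z (sphere_subset_closedBall hz))).div_const 2
  have key := hasSum_iteratedDeriv_of_summable_norm hRpos hu_sum hf_diff hle hg_diff hsum k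
  -- evaluate
  have hk0 : 0 < k := hk
  have hg_eval : iteratedDeriv k g s = iteratedDeriv k (fun z ↦ digamma (z / 2) / 2) s := by
    rw [hg]
    have : (fun z ↦ (digamma (z / 2) + (Real.eulerMascheroniConstant : ℂ)) / 2) =
        fun z ↦ (Real.eulerMascheroniConstant : ℂ) / 2 + digamma (z / 2) / 2 := by funext z; ring
    rw [this, iteratedDeriv_const_add hk0]
  have hf_eval : ∀ j : ℕ, iteratedDeriv k (f j) s =
      (-1) ^ (k + 1) * (k.factorial : ℂ) * ((s + 2 * j) ^ (k + 1))⁻¹ := by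
    intro j
    have hfj : f j = fun z ↦ 1 / (2 * ((j : ℂ) + 1)) - (fun x : ℂ ↦ (x + 2 * (j : ℂ))⁻¹) z := by
      funext z; rw [hf]; dsimp only
      have h2 : (2 : ℂ) ≠ 0 := two_ne_zero
      have hj1 : ((j : ℂ) + 1) ≠ 0 := by exact_mod_cast Nat.succ_ne_zero j
      by_cases hz : z + 2 * (j : ℂ) = 0
      · have : z / 2 + j = 0 := by linear_combination hz / 2
        rw [hz, this]
        simp only [div_zero, inv_zero, sub_zero]
        field_simp
      · have : z / 2 + j ≠ 0 := fun h ↦ hz (by linear_combination 2 * h)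
        field_simp
    rw [hfj, iteratedDeriv_const_sub hk0, iteratedDeriv_neg, iteratedDeriv_inv_add_const]
    ring
  rw [hg_eval] at key
  exact key.congr_fun fun j ↦ (hf_eval j).symm

end Literature.Analysis.SpecialFunctions.Complex

end
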